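import Literature.AnabelianGeometry.SemiGraphs.ProSigmaCompletionExtend
import Mathlib.LinearAlgebra.StdBasis
import Mathlib.Algebra.Module.Equiv.Basic
import Mathlib.Data.ZMod.Basic
import HarnessLib

/-!
# Pro-`Σ` completions: counting continuous homomorphisms to a finite `Σ`-group; rank invariance

Group theory behind the RANK statements of [CombGC] Remarks 1.1.3 / 1.1.4 / 1.3.1 (Mochizuki, *A
combinatorial version of the Grothendieck conjecture*, Tohoku Math. J. **59** (2007), pp. 7–10: "free of
rank `n(G) − i(G) + 1` over `Ẑ^Σ`", "the ranks [over `Ẑ^Σ`] … coincide"), as typed in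
`PSCGraphicitySub.lean` through abc-iut-L3-t1's interface `SemiGraphOfAnabelioids.IsProSigmaCompletion`
([SemiAnbd] Ex. 2.10): a free `Ẑ^Σ`-module of rank `r` is rendered as "a pro-`Σ` completion of `ℤ^r`".
For that rendering to carry the printed rank arguments ([CombGC] proof of Thm. 1.6 (ii): "by Proposition
1.3 … `α` is numerically cuspidal", i.e. ranks are read off the topological groups), the rank must be an
INVARIANT of the topological group.  Proved here (sub-DAG row CombGC:Thm1.6/T16-L08, "classical"):

* `natCard_continuousMonoidHom_eq` — for `ι : Γ → P` a pro-`Σ` completion (`P` profinite) and `Q` a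
  finite group of `Σ`-integer order, restriction along `ι` is a bijection
  `{continuous P → Q} ≃ (Γ → Q)` (existence = abc-iut-L3-t1 lineage's `exists_continuous_extend_top`,
  uniqueness = density);
* `natCard_addMonoidHom_pi_int_zmod` — `#Hom(ℤ^r, ℤ/l) = l^r`;
* `rank_eq_of_continuousMulEquiv` — **rank invariance**: if `P ≅ P'` as topological groups and `P`,
  `P'` are pro-`Σ` completions of `ℤ^r`, `ℤ^s` with `Σ ∋ l` a prime, then `r = s`.

Plain (pro)finite group theory; no statement of the papers is restated; nothing here takes a side on
[IUTchIII] Cor. 3.12. [cite: MochizukiCombGC2007, Rmk 1.1.4 p.8]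
-/

namespace Literature.AnabelianGeometry.SemiGraphs.SemiGraphOfAnabelioids.IsProSigmaCompletion

open Literature.AnabelianGeometry.Anabelioids Topology

variable {Sigma : Set ℕ} {Γ : Type*} [Group Γ] {P : Type*} [Group P] [TopologicalSpace P]
  [IsTopologicalGroup P] [CompactSpace P] [TotallyDisconnectedSpace P] {ι : Γ →* P}

/-! ### Continuous homomorphisms to a finite `Σ`-group are the homomorphisms of `Γ` -/

/-- **Restriction along a pro-`Σ` completion is a bijection on homomorphisms to finite `Σ`-groups**:
for `Q` finite (discrete) of `Σ`-integer order, `F ↦ F ∘ ι` identifies the continuous homomorphisms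
`P → Q` with the homomorphisms `Γ → Q` — so their number is an invariant of the topological group `P`
computed on `Γ`. [cite: MochizukiSemiAnbd2006, Ex. 2.10 p.31] -/
theorem natCard_continuousMonoidHom_eq (hι : IsProSigmaCompletion Sigma ι) {Q : Type*} [Group Q]
    [Finite Q] [TopologicalSpace Q] [DiscreteTopology Q] (hQ : IsSigmaInteger Sigma (Nat.card Q)) :
    Nat.card {F : P →* Q // Continuous F} = Nat.card (Γ →* Q) := by
  refine Nat.card_congr (Equiv.ofBijective (fun F => F.1.comp ι) ⟨fun F F' h => ?_, fun f => ?_⟩)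
  · apply Subtype.ext
    have key : (F.1 : P → Q) = F'.1 :=
      Continuous.ext_on hι.dense F.2 F'.2 (by
        rintro _ ⟨γ, rfl⟩
        exact DFunLike.congr_fun h γ)
    exact DFunLike.coe_injective key
  · obtain ⟨F, hFc, hF⟩ := exists_continuous_extend_top hι hQ f
    exact ⟨⟨F, hFc⟩, MonoidHom.ext hF⟩

omit [IsTopologicalGroup P] [CompactSpace P] [TotallyDisconnectedSpace P] in
/-- Continuous homomorphisms to `Q` are transported along an isomorphism of topological groups.
[cite: MochizukiSemiAnbd2006, Ex. 2.10 p.31] -/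
theorem natCard_continuousMonoidHom_congr {P' : Type*} [Group P'] [TopologicalSpace P']
    (e : P ≃ₜ* P') (Q : Type*) [Group Q] [TopologicalSpace Q] :
    Nat.card {F : P →* Q // Continuous F} = Nat.card {F : P' →* Q // Continuous F} := by
  refine Nat.card_congr
    { toFun := fun F => ⟨F.1.comp e.symm.toMulEquiv.toMonoidHom, F.2.comp e.symm.continuous⟩
      invFun := fun F => ⟨F.1.comp e.toMulEquiv.toMonoidHom, F.2.comp e.continuous⟩
      left_inv := fun F => Subtype.ext (MonoidHom.ext fun x => ?_)
      right_inv := fun F => Subtype.ext (MonoidHom.ext fun x => ?_) }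
  · change F.1 (e.symm (e x)) = F.1 x
    rw [e.symm_apply_apply]
  · change F.1 (e (e.symm x)) = F.1 x
    rw [e.apply_symm_apply]

/-! ### `#Hom(ℤ^r, ℤ/l) = l^r` -/

/-- The homomorphisms `ℤ^r → ℤ/l` are the `r`-tuples of elements of `ℤ/l` (values on the standard
basis): there are `l^r` of them (`l ≥ 1`). [cite: MochizukiCombGC2007, Rmk 1.1.4 p.8] -/
theorem natCard_addMonoidHom_pi_int_zmod (r l : ℕ) [NeZero l] :
    Nat.card ((Fin r → ℤ) →+ ZMod l) = l ^ r := by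
  have e : ((Fin r → ℤ) →+ ZMod l) ≃ (Fin r → ZMod l) :=
    ((addMonoidHomLequivInt (A := Fin r → ℤ) (B := ZMod l) ℤ).toEquiv.trans
      ((Pi.basisFun ℤ (Fin r)).constr ℤ).toEquiv.symm)
  rw [Nat.card_congr e, Nat.card_fun, Nat.card_zmod, Nat.card_eq_fintype_card, Fintype.card_fin]

/-- The same count for the multiplicative copies used by `IsProSigmaCompletion` (`Γ →* P` with
`Γ = Multiplicative ℤ^r`). [cite: MochizukiCombGC2007, Rmk 1.1.4 p.8] -/
theorem natCard_monoidHom_zpow_zmod (r l : ℕ) [NeZero l] :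
    Nat.card (Multiplicative (Fin r → ℤ) →* Multiplicative (ZMod l)) = l ^ r := by
  rw [Nat.card_congr (AddMonoidHom.toMultiplicative (α := Fin r → ℤ) (β := ZMod l)).symm,
    natCard_addMonoidHom_pi_int_zmod]

/-- A prime `l ∈ Σ` has `Σ`-integer powers; in particular `#(ℤ/l) = l` is a `Σ`-integer.
[cite: MochizukiSemiAnbd2006, Ex. 2.10 p.31] -/
theorem isSigmaInteger_card_zmod {l : ℕ} (hl : l.Prime) (hlS : l ∈ Sigma) :
    IsSigmaInteger Sigma (Nat.card (Multiplicative (ZMod l))) := by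
  rw [Nat.card_congr Multiplicative.toAdd, Nat.card_zmod]
  exact ⟨hl.pos, fun p hp hpl => by rwa [(Nat.prime_dvd_prime_iff_eq hp hl).mp hpl]⟩

/-! ### Rank invariance -/

/-- **The number of continuous homomorphisms `P → ℤ/l`** of a pro-`Σ` completion `P` of `ℤ^r`
(`P` profinite, `l ∈ Σ` prime) is `l^r`. [cite: MochizukiCombGC2007, Rmk 1.1.4 p.8] -/
theorem natCard_continuousMonoidHom_zmod {r : ℕ} {ι : Multiplicative (Fin r → ℤ) →* P}
    (hι : IsProSigmaCompletion Sigma ι) {l : ℕ} (hl : l.Prime) (hlS : l ∈ Sigma) :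
    Nat.card {F : P →* Multiplicative (ZMod l) //
        @Continuous P (Multiplicative (ZMod l)) _ ⊥ F} = l ^ r := by
  haveI : NeZero l := ⟨hl.ne_zero⟩
  haveI : Finite (Multiplicative (ZMod l)) := Finite.of_equiv _ Multiplicative.ofAdd
  letI : TopologicalSpace (Multiplicative (ZMod l)) := ⊥
  haveI : DiscreteTopology (Multiplicative (ZMod l)) := ⟨rfl⟩
  rw [natCard_continuousMonoidHom_eq hι (isSigmaInteger_card_zmod hl hlS),
    natCard_monoidHom_zpow_zmod]

/-- **Rank invariance for pro-`Σ` completions of free abelian groups** (what "free of rank `r` over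
`Ẑ^Σ`" needs in order to be read off the topological group, [CombGC] Rmk. 1.1.4 / 1.3.1): if the
profinite groups `P ≅ P'` are isomorphic as topological groups and are pro-`Σ` completions of `ℤ^r`,
`ℤ^s` respectively, `Σ` containing a prime `l`, then `r = s`. [cite: MochizukiCombGC2007, Rmk 1.3.1 p.10] -/
theorem rank_eq_of_continuousMulEquiv {P' : Type*} [Group P'] [TopologicalSpace P']
    [IsTopologicalGroup P'] [CompactSpace P'] [TotallyDisconnectedSpace P'] {r s : ℕ}
    {ι : Multiplicative (Fin r → ℤ) →* P} {ι' : Multiplicative (Fin s → ℤ) →* P'}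
    (hι : IsProSigmaCompletion Sigma ι) (hι' : IsProSigmaCompletion Sigma ι') {l : ℕ} (hl : l.Prime)
    (hlS : l ∈ Sigma) (e : P ≃ₜ* P') : r = s := by
  letI : TopologicalSpace (Multiplicative (ZMod l)) := ⊥
  have h1 := natCard_continuousMonoidHom_zmod hι hl hlS
  have h2 := natCard_continuousMonoidHom_zmod hι' hl hlS
  rw [natCard_continuousMonoidHom_congr e] at h1
  exact Nat.pow_right_injective hl.two_le (h1.symm.trans h2)

end Literature.AnabelianGeometry.SemiGraphs.SemiGraphOfAnabelioids.IsProSigmaCompletion
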